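import Literature.Analysis.FluidPDE.NSBackwardUniquenessFiniteEnergy
import Literature.Analysis.FluidPDE.NSBoundedClassicalSobolevClass
import Literature.Analysis.FluidPDE.BackwardUniquenessSobolevClass
import Literature.Analysis.FluidPDE.NSViscosityRescaling
import HarnessLib

/-!
# Backward uniqueness of bounded finite-energy classical Navier–Stokes solutions on `ℝ³` — discharge

Analysis/FluidPDE proof file (theorems only: no definition, no named fact). It DISCHARGES the named
fact `Literature.Analysis.FluidPDE.ns_backward_uniqueness_finiteEnergy`
(`NSBackwardUniquenessFiniteEnergy.lean`):

> two classical solutions of the free Navier–Stokes system on `[0, T] × ℝ³` (`ν > 0`), each with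
> bounded velocity and uniformly bounded energy on the slab, which coincide at time `T`, coincide
> at time `0`.

Proof, following the printed road (I. Kukavica, Proc. AMS 135 (2007), Thm. 2.1, classical case;
R. Temam, *Infinite-Dimensional Dynamical Systems*, 2nd ed. 1997, Ch. III §6, Lemmas 6.1–6.2 and
§6.2; the regularity inputs of J. Serrin 1962 / Robinson–Rodrigo–Sadowski 2016, Thm. 8.17), with
every step taken from the tree:

1. **Unit viscosity, positive times.** A bounded finite-energy classical solution `u` of the unit
   viscosity system on `[0, T] × ℝ³` has, for every `0 < δ < T`, a translate `u(· + δ)` which is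
   the velocity of a Tao-class solution on `[0, T - δ]` (`u, ∂ₜu, q ∈ L^∞_t H^k_x` for all `k`):
   `IsClassicalNSSolutionOn.exists_isTaoSolutionOn_translate_of_bounded`
   (`NSBoundedClassicalSobolevClass`: Leray–Hopf by finite energy, Serrin's `L²L^∞` criterion,
   `H¹ ⇒ H^k` smoothing). Two such solutions agreeing at `T` agree on `[δ, T]` by the tree's
   log-convexity theorem in Tao's class, `IsTaoSolutionOn.backward_unique`
   (`BackwardUniquenessSobolevClass`, Temam Ch. III §6).
2. **Time `0`.** The time lines `t ↦ uᵢ(t, x)` are continuous within `[0, T]` (joint smoothness on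
   the closed slab), and `u₁(t, x) = u₂(t, x)` for `t ∈ (0, T)`; hence `u₁(0, x) = u₂(0, x)`
   (uniqueness of limits along `𝓝[(0, T)] 0`).
3. **General viscosity** by the parabolic rescaling `v(s, x) = ν⁻¹ u(ν⁻¹ s, x)`,
   `q(s, x) = ν⁻² p(ν⁻¹ s, x)`, which solves the unit-viscosity system on `[0, νT]`
   (`IsClassicalNSSolutionOn.viscosityRescale_zero`, `NSViscosityRescaling`), stays bounded, keeps
   bounded energy (`lintegral_enorm_sq_const_smul`), and has `v(νT) = ν⁻¹ u(T)`, `v(0) = ν⁻¹ u(0)`.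

* `ns_backward_uniqueness_finiteEnergy_holds` — the discharge `theorem … : ns_backward_uniqueness_finiteEnergy`.

Consumer: `Summits/NavierStokesRegularity/NavierStokesRegularity/Cruxes/EpisodeBaseT/Lines/robustmirror.lean`
(`robust_mirror_decides₁ (hBU : ns_backward_uniqueness_finiteEnergy)`), now fed
`ns_backward_uniqueness_finiteEnergy_holds`. WHAT THIS IS NOT: not a statement about Navier–Stokes
regularity or blow-up — uniqueness of GIVEN smooth flows in a printed class.

## References

* I. Kukavica, *Log-log convexity and backward uniqueness*, Proc. Amer. Math. Soc. 135 (2007)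
  2415–2421, §2 Thm. 2.1. [Kukavica2007]
* R. Temam, *Infinite-Dimensional Dynamical Systems in Mechanics and Physics*, 2nd ed., Springer
  1997, Ch. III §6, Lemmas 6.1–6.2, §6.2. [Temam1997]
* J. C. Robinson, J. L. Rodrigo, W. Sadowski, *The Three-Dimensional Navier–Stokes Equations*,
  CUP 2016, Thm. 8.17, Thm. 7.5. [RobinsonRodrigoSadowski2016]
-/

noncomputable section

open MeasureTheory Set Function Filter
open _root_.Topology
open scoped NNReal ENNReal

namespace Literature.Analysis.FluidPDE

variable {T : ℝ} {u₁ u₂ : ℝ → EuclideanSpace ℝ (Fin 3) → EuclideanSpace ℝ (Fin 3)}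
  {p₁ p₂ : ℝ → EuclideanSpace ℝ (Fin 3) → ℝ}

/-- Step 1 (unit viscosity, positive times): two bounded finite-energy classical solutions of the
unit-viscosity free system on `[0, T] × ℝ³` which agree at `T` agree at every `δ ∈ (0, T)` — both
translates `uᵢ(· + δ)` are Tao-class on `[0, T - δ]` and the tree's `IsTaoSolutionOn.backward_unique`
applies. [cite: Temam1997, Ch. III §6.2 with Lemma 6.2 (pp. 171–175)] -/
private theorem slice_eq_of_bounded_finiteEnergy_one (hT : 0 < T)
    (h₁ : IsClassicalNSSolutionOn (Icc 0 T) 1 0 u₁ p₁) (h₂ : IsClassicalNSSolutionOn (Icc 0 T) 1 0 u₂ p₂)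
    {M₁ M₂ : ℝ} (hM₁ : ∀ t ∈ Icc 0 T, ∀ x, ‖u₁ t x‖ ≤ M₁) (hM₂ : ∀ t ∈ Icc 0 T, ∀ x, ‖u₂ t x‖ ≤ M₂)
    (hfe₁ : ∃ A : ℝ≥0∞, A < ⊤ ∧ ∀ t ∈ Icc 0 T, ∫⁻ x, ‖u₁ t x‖ₑ ^ 2 ≤ A)
    (hfe₂ : ∃ A : ℝ≥0∞, A < ⊤ ∧ ∀ t ∈ Icc 0 T, ∫⁻ x, ‖u₂ t x‖ₑ ^ 2 ≤ A)
    (hend : u₁ T = u₂ T) {δ : ℝ} (hδ : 0 < δ) (hδT : δ < T) : u₁ δ = u₂ δ := by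
  obtain ⟨q₁, hq₁⟩ := h₁.exists_isTaoSolutionOn_translate_of_bounded hT hfe₁ hM₁ hδ hδT
  obtain ⟨q₂, hq₂⟩ := h₂.exists_isTaoSolutionOn_translate_of_bounded hT hfe₂ hM₂ hδ hδT
  have hT' : 0 < T - δ := sub_pos.2 hδT
  have hfin : (fun t => u₁ (t + δ)) (T - δ) = (fun t => u₂ (t + δ)) (T - δ) := by
    simp only [sub_add_cancel]
    exact hend
  have h := hq₁.backward_unique hT' one_pos hq₂ hfin 0 ⟨le_rfl, hT'.le⟩
  simpa only [zero_add] using h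

/-- Steps 1–2 (unit viscosity): equality at time `0`, by continuity of the time lines within
`[0, T]` and uniqueness of limits along `𝓝[(0, T)] 0`. [cite: Temam1997, Ch. III §6.2 with Lemma 6.2 (pp. 171–175)] -/
private theorem initial_eq_of_bounded_finiteEnergy_one (hT : 0 < T)
    (h₁ : IsClassicalNSSolutionOn (Icc 0 T) 1 0 u₁ p₁) (h₂ : IsClassicalNSSolutionOn (Icc 0 T) 1 0 u₂ p₂)
    {M₁ M₂ : ℝ} (hM₁ : ∀ t ∈ Icc 0 T, ∀ x, ‖u₁ t x‖ ≤ M₁) (hM₂ : ∀ t ∈ Icc 0 T, ∀ x, ‖u₂ t x‖ ≤ M₂)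
    (hfe₁ : ∃ A : ℝ≥0∞, A < ⊤ ∧ ∀ t ∈ Icc 0 T, ∫⁻ x, ‖u₁ t x‖ₑ ^ 2 ≤ A)
    (hfe₂ : ∃ A : ℝ≥0∞, A < ⊤ ∧ ∀ t ∈ Icc 0 T, ∫⁻ x, ‖u₂ t x‖ₑ ^ 2 ≤ A)
    (hend : u₁ T = u₂ T) : u₁ 0 = u₂ 0 := by
  funext x
  have h0 : (0 : ℝ) ∈ Icc 0 T := ⟨le_rfl, hT.le⟩
  have hU : UniqueDiffOn ℝ (Icc 0 T) := uniqueDiffOn_Icc hT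
  have hc₁ : Tendsto (fun t => u₁ t x) (𝓝[Ioo 0 T] 0) (𝓝 (u₁ 0 x)) :=
    ((h₁.smooth_velocity.hasDerivWithinAt_timeDerivWithin hU h0 x).continuousWithinAt.tendsto).mono_left
      (nhdsWithin_mono _ Ioo_subset_Icc_self)
  have hc₂ : Tendsto (fun t => u₂ t x) (𝓝[Ioo 0 T] 0) (𝓝 (u₂ 0 x)) :=
    ((h₂.smooth_velocity.hasDerivWithinAt_timeDerivWithin hU h0 x).continuousWithinAt.tendsto).mono_left
      (nhdsWithin_mono _ Ioo_subset_Icc_self)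
  have heq : (fun t => u₁ t x) =ᶠ[𝓝[Ioo 0 T] 0] fun t => u₂ t x :=
    eventually_mem_nhdsWithin.mono fun t ht =>
      congr_fun (slice_eq_of_bounded_finiteEnergy_one hT h₁ h₂ hM₁ hM₂ hfe₁ hfe₂ hend ht.1 ht.2) x
  haveI := left_nhdsWithin_Ioo_neBot hT
  exact tendsto_nhds_unique_of_eventuallyEq hc₁ hc₂ heq

/-- **Backward uniqueness of bounded finite-energy classical Navier–Stokes solutions on `ℝ³`**
(discharge of `ns_backward_uniqueness_finiteEnergy`): two classical solutions of the free system on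
`[0, T] × ℝ³` (`ν > 0`) with bounded velocities and uniformly bounded energies which coincide at
time `T` coincide at time `0`. Log-convexity in the `L²`-Sobolev class (Kukavica 2007, Thm. 2.1,
classical case; Temam 1997, Ch. III §6) after Serrin regularisation of bounded Leray–Hopf
solutions, transported to general `ν` by the parabolic rescaling `u ↦ ν⁻¹u(ν⁻¹·)`.
[cite: Kukavica2007, §2 Thm. 2.1 (p. 2417), classical case] [cite: Temam1997, Ch. III §6, Lemmas 6.1–6.2 and §6.2 (6.16)–(6.17)] -/
theorem ns_backward_uniqueness_finiteEnergy_holds : ns_backward_uniqueness_finiteEnergy := by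
  intro ν T hν hT u₁ u₂ p₁ p₂ h₁ h₂ hb₁ hb₂ hfe₁ hfe₂ hend
  obtain ⟨M₁, hM₁⟩ := hb₁
  obtain ⟨M₂, hM₂⟩ := hb₂
  obtain ⟨A₁, hA₁, hE₁⟩ := hfe₁
  obtain ⟨A₂, hA₂, hE₂⟩ := hfe₂
  -- parabolic rescaling to unit viscosity on `[0, νT]`
  have hr₁ := h₁.viscosityRescale_zero hν hT
  have hr₂ := h₂.viscosityRescale_zero hν hT
  have hνT : 0 < ν * T := mul_pos hν hT
  have hν0 : 0 ≤ ν⁻¹ := inv_nonneg.2 hν.le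
  have hmaps := mapsTo_inv_mul_Icc (T := T) hν
  have hbound : ∀ {u : ℝ → EuclideanSpace ℝ (Fin 3) → EuclideanSpace ℝ (Fin 3)} {M : ℝ},
      (∀ t ∈ Icc 0 T, ∀ x, ‖u t x‖ ≤ M) →
      ∀ s ∈ Icc 0 (ν * T), ∀ x, ‖timeRescale ν⁻¹ ν⁻¹ u s x‖ ≤ ν⁻¹ * M := by
    intro u M hM s hs x
    rw [timeRescale_apply, norm_smul, Real.norm_of_nonneg hν0]
    exact mul_le_mul_of_nonneg_left (hM _ (hmaps hs) x) hν0
  have henergy : ∀ {u : ℝ → EuclideanSpace ℝ (Fin 3) → EuclideanSpace ℝ (Fin 3)} {A : ℝ≥0∞},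
      A < ⊤ → (∀ t ∈ Icc 0 T, ∫⁻ x, ‖u t x‖ₑ ^ 2 ≤ A) →
      ∃ A' : ℝ≥0∞, A' < ⊤ ∧ ∀ s ∈ Icc 0 (ν * T), ∫⁻ x, ‖timeRescale ν⁻¹ ν⁻¹ u s x‖ₑ ^ 2 ≤ A' := by
    intro u A hA hE
    refine ⟨ENNReal.ofReal (ν⁻¹ ^ 2) * A, ENNReal.mul_lt_top ENNReal.ofReal_lt_top hA, fun s hs => ?_⟩
    rw [timeRescale_slice, lintegral_enorm_sq_const_smul]
    exact mul_le_mul' le_rfl (hE _ (hmaps hs))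
  have hend' : timeRescale ν⁻¹ ν⁻¹ u₁ (ν * T) = timeRescale ν⁻¹ ν⁻¹ u₂ (ν * T) := by
    rw [timeRescale_slice, timeRescale_slice, ← mul_assoc, inv_mul_cancel₀ hν.ne', one_mul, hend]
  have h0 := initial_eq_of_bounded_finiteEnergy_one hνT hr₁ hr₂ (hbound hM₁) (hbound hM₂)
    (henergy hA₁ hE₁) (henergy hA₂ hE₂) hend'
  rw [timeRescale_zero, timeRescale_zero] at h0
  funext x
  exact smul_right_injective _ (inv_ne_zero hν.ne') (congr_fun h0 x)

end Literature.Analysis.FluidPDE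

end
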